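import Summits.QuantumFields.BalabanUV.Beta.GAN24.WhitneyRowDefectBound
import Summits.QuantumFields.BalabanUV.Beta.GAN24.HkOpBlockProfile
import Summits.QuantumFields.BalabanUV.T4Continuum.Support.AveragingKernelRows

/-!
# `BalabanUV.Beta.GAN24.WhitneyRowDefectBoundDecay` — binder row G-an2-4 ∕ (CONV-C), routes R1 ∕ R6 ∕ R7 at `U = 1`: THE SIZE OF THE HONEST ROW DEFECT,
# VOLUME-FREE — `nsq (Q_{Lc^{j+1}}(PcoMat j (H_{Lc^j}B)) − B) ≤ ρ_j²·nsq B`, `ρ_j = C(d, Lc)·Lc^{−j}` INDEPENDENT OF THE TORUS (unit b2b-balaban-gan24-p3, gen 49; v1 —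
# the decaying twin of `WhitneyRowDefectBound`, dimension written `d + 1` as in b05's decay engine)

NOT IN PRINT; OUR PROOF ([folklore] finite sums over TREE objects BY NAME).  HONEST FRAMING (cell contract, verbatim): «discharging `BetaPertH` makes Bałaban's UV
stability UNCONDITIONAL — a real constructive-QFT result; it is NOT the continuum limit and NOT the Clay problem.»  HONEST DEPENDENCY (verbatim): «continuum YM on T⁴ ⇐
BetaPertH ∧ nine spine estimates (0/9 proved); BetaPertH ⇐ (D1) ∧ (D4) ∧ CAP+tail; G-an2-4 gates asym, D1 and NE2/3/4.»
MECHANISM: `WhitneyRowDefectBound` with b05's sup bound of the gradient kernel replaced by its DECAYING form at an arbitrary fine point (`GradientVertexChainKing.norm_dker_le_block`):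
one unit step of `H_nB` at `x` costs `CdecD∕n·Φ_B(blk x)`, `Φ_B(b) := Σ_y e^{−dec|b − y|_T}·Σ_λ|B_λ(y)|` (the block profile); a unit step moves the block by at most one unit step
(`AveragedPropagatorLocality.blockOf_add_unitVec`), adjacent blocks cost `e^{dec}` (`exp_tsn_le_of_adj`); the line points of the reading lie within block distance one
(`AveragingKernelRows.torusSupNorm_blockOf_line_le_one`); the volume-free torus sum `Σ_y e^{−dec|x − y|_T} ≤ K_{d+1}(dec)` (`sum_exp_torusSupNorm_sub_rep_le`) and weighted
Cauchy–Schwarz (Young on the torus) close the `ℓ²` bound.  CONTENT (0 sorry, 0 `def`; §1 = companion `HkOpBlockProfile`): §2 **`norm_cstep_PcoMat_sub_le_decay`**,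
`phi_blockOf_line_le`, `norm_honestDefect_apply_le`; §3 `sum_phi_sq_le`, **`nsq_honestDefect_le_decay`**:
`nsq δ_j(B) ≤ ((d+1)·K_{d+1}(dec)·(Lc+d+1)·e^{dec(Lc+d+1)}·e^{dec}·CdecD∕Lc^j)²·nsq B` for every `Lc ≥ 1`, torus `M`, `j`, `B`.  HONEST SCOPE: first order (`Lc^{−j}`); constants ours,
crude, functions of `(d, Lc)` only; `U = 1`, torus model; NOT (CONV-C), NOT D1, NOT `BetaPertH`, NOT continuum, NOT Clay; NEVER «G-an2-4 closed».
-/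

noncomputable section

namespace Summit.QuantumFields.BalabanUV.Beta.GAN24.WhitneyRowDefectBoundDecay

open Matrix Finset
open scoped BigOperators ComplexOrder
open Literature.MathematicalPhysics.QuantumFieldTheory.Balaban1983to89
open Literature.MathematicalPhysics.QuantumFieldTheory.Balaban1983to89.B5Prop11Plancherel (Tor fine unitVec)
open Literature.MathematicalPhysics.QuantumFieldTheory.Balaban1983to89.B5Prop11Lower (nsq nsq_nonneg)
open Literature.MathematicalPhysics.QuantumFieldTheory.Balaban1983to89.B4TorusKernel.MultiPeriod (torusSupNorm)
open Literature.MathematicalPhysics.QuantumFieldTheory.Balaban1983to89.B4Sect5Proof (latticeConst latticeConst_nonneg)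
open Literature.MathematicalPhysics.QuantumFieldTheory.Balaban1983to89.B5Block118 (QvOp QvOp_mulVec lineSum bpt tstep tstep_zero tstep_succ)
open Literature.MathematicalPhysics.QuantumFieldTheory.Balaban1983to89.B5Blocks16 (blockOf blockOf_bpt)
open Literature.MathematicalPhysics.QuantumFieldTheory.Balaban1983to89.B6LowerBound2153Torus (toT rep toT_rep)
open Literature.MathematicalPhysics.QuantumFieldTheory.Balaban1983to89.B5Action121 (fdiff_mulVec_apply sdiff_mulVec comp)
open Literature.MathematicalPhysics.QuantumFieldTheory.Balaban1983to89.B5G183RateTorus (cpt)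
open Literature.MathematicalPhysics.QuantumFieldTheory.Balaban1983to89.B5G183RateTorusW (off)
open Literature.MathematicalPhysics.QuantumFieldTheory.Balaban1983to89.B5Hk163Torus (HkOp QvOp_HkOp_mulVec)
open Literature.MathematicalPhysics.QuantumFieldTheory.Balaban1983to89.B5Hk163TorusHolder (dker fdiff_HkOp_mulVec)
open Literature.MathematicalPhysics.QuantumFieldTheory.Balaban1983to89.B5Hk163TorusHolderDecay (CdecD CdecD_nonneg)
open Literature.MathematicalPhysics.QuantumFieldTheory.Balaban1983to89.B5Hk163TorusHolderRate (sum_exp_torusSupNorm_sub_rep_le)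
open Summit.QuantumFields.BalabanUV.T4Continuum.BalabanAveragedTowerModes (par)
open Summit.QuantumFields.BalabanUV.T4Continuum.SmallCouplingEntryDecay (torusSupNorm_rep_triangle torusSupNorm_rep_nonneg)
open Summit.QuantumFields.BalabanUV.T4Continuum.AveragingKernelRows (torusSupNorm_blockOf_line_le_one torusSupNorm_rep_sub_comm)
open Summit.QuantumFields.BalabanUV.Beta.GAN24.MonotoneTorusTower (Lev sread cstep)
open Summit.QuantumFields.BalabanUV.Beta.GAN24.MultilinearProlongation (vtx vtx_insert vwt sum_vwt vwt_nonneg twR twR_nonneg twR_le_one)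
open Summit.QuantumFields.BalabanUV.Beta.GAN24.MonotoneTorusSqueeze (castS PcoMat)
open Summit.QuantumFields.BalabanUV.Beta.GAN24.HkKingOneStep (dec dec_pos)
open Summit.QuantumFields.BalabanUV.Beta.GAN24.HkOpBlockProfile (norm_HkOp_tstep_le_decay norm_HkOp_vtx_le_decay phi_blockOf_add_tstep_le)
open Summit.QuantumFields.BalabanUV.Beta.GAN24.WhitneyRowDefectBound (par_cpt_add_off_tstep cstep_mulVec_apply PcoMat_mulVec_apply honestDefect_eq_sread)

variable {d : ℕ}

/-! ## §2 The pointwise defect against the block profile; the reading -/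

section Defect

variable (Lc : ℕ) [NeZero Lc] (M : Fin (d + 1) → ℕ) [hM : ∀ μ, NeZero (M μ)]

/-- **THE POINTWISE DEFECT, DECAYING FORM**: `|((cstep j·PcoMat j)(H_{Lc^j}B))(z,ν) − (H_{Lc^j}B)(z,ν)| ≤ (Lc+d+1)·e^{dec(Lc+d+1)}·CdecD∕Lc^j·Φ_B(blk z)` — as in
`WhitneyRowDefectBound.norm_cstep_PcoMat_sub_le`, every value read lying within `c + |T| ≤ Lc + d + 1` unit steps of `z`, each step costing `CdecD∕n` times the block profile,
which grows by at most `e^{dec}` per step. [folklore] -/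
theorem norm_cstep_PcoMat_sub_le_decay (j : ℕ) (B : Tor M × Fin (d + 1) → ℂ) (z : Tor (fine (Lc ^ j) M)) (ν : Fin (d + 1)) :
    ‖(cstep Lc M j *ᵥ (PcoMat Lc M j *ᵥ (HkOp (Lc ^ j) M *ᵥ B))) (z, ν) - (HkOp (Lc ^ j) M *ᵥ B) (z, ν)‖
      ≤ ((Lc : ℝ) + (d + 1)) * Real.exp (dec d * ((Lc : ℝ) + (d + 1))) *
          (CdecD d / ((Lc ^ j : ℕ) : ℝ) *
            ∑ y : Tor M, Real.exp (-(dec d * torusSupNorm M (rep M (blockOf (Lc ^ j) M z) - rep M y))) * ∑ lam : Fin (d + 1), ‖B (y, lam)‖) := by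
  set A := HkOp (Lc ^ j) M *ᵥ B with hA
  set Φ := ∑ y : Tor M, Real.exp (-(dec d * torusSupNorm M (rep M (blockOf (Lc ^ j) M z) - rep M y))) * ∑ lam : Fin (d + 1), ‖B (y, lam)‖ with hΦ
  set K := CdecD d / ((Lc ^ j : ℕ) : ℝ) with hK
  set E := Real.exp (dec d * ((Lc : ℝ) + (d + 1))) with hE
  have hK0 : 0 ≤ K := div_nonneg CdecD_nonneg (Nat.cast_nonneg _)
  have hΦ0 : 0 ≤ Φ := Finset.sum_nonneg fun y _ => mul_nonneg (Real.exp_pos _).le (Finset.sum_nonneg fun _ _ => norm_nonneg _)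
  have hE0 : 0 ≤ E := (Real.exp_pos _).le
  have hdec := (dec_pos d).le
  -- (a) every value read is within `(Lc + d + 1)·E·K·Φ` of `A (z, ν)`
  have hval : ∀ (jj : Fin (d + 1) → Fin Lc) (t : Fin Lc) (T : Finset (Fin (d + 1))),
      ‖A (par (Lc ^ j) Lc M (cpt (Lc ^ j) Lc M z + off (Lc ^ j) Lc M jj + tstep (fine (Lc * Lc ^ j) M) ν t) + vtx (fine (Lc ^ j) M) T, ν)
          - A (z, ν)‖ ≤ ((Lc : ℝ) + (d + 1)) * E * (K * Φ) := by
    intro jj t T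
    obtain ⟨c, hc, hpar⟩ := par_cpt_add_off_tstep Lc M j z jj ν (t : ℕ)
    rw [hpar]
    have h1 := norm_HkOp_vtx_le_decay (Lc ^ j) M B (z + tstep (fine (Lc ^ j) M) ν c) ν T
    have h2 := norm_HkOp_tstep_le_decay (Lc ^ j) M B z ν ν c
    have h3 := phi_blockOf_add_tstep_le (Lc ^ j) M B z ν c
    have hT : (T.card : ℝ) ≤ d + 1 := by exact_mod_cast (card_le_univ T).trans_eq (Fintype.card_fin (d + 1))
    have hc' : (c : ℝ) ≤ Lc := by exact_mod_cast hc.trans t.isLt.le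
    have heT : Real.exp (dec d * T.card) * Real.exp (dec d * c) ≤ E := by
      rw [← Real.exp_add, hE]
      exact Real.exp_le_exp.mpr (by nlinarith)
    have hec : Real.exp (dec d * c) ≤ E := Real.exp_le_exp.mpr (by nlinarith)
    have heT0 : 0 ≤ Real.exp (dec d * T.card) := (Real.exp_pos _).le
    have hec0 : 0 ≤ Real.exp (dec d * c) := (Real.exp_pos _).le
    calc ‖A (z + tstep (fine (Lc ^ j) M) ν c + vtx (fine (Lc ^ j) M) T, ν) - A (z, ν)‖
        ≤ ‖A (z + tstep (fine (Lc ^ j) M) ν c + vtx (fine (Lc ^ j) M) T, ν) - A (z + tstep (fine (Lc ^ j) M) ν c, ν)‖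
            + ‖A (z + tstep (fine (Lc ^ j) M) ν c, ν) - A (z, ν)‖ := norm_sub_le_norm_sub_add_norm_sub _ _ _
      _ ≤ T.card * Real.exp (dec d * T.card) * (K * (Real.exp (dec d * c) * Φ)) + c * Real.exp (dec d * c) * (K * Φ) :=
          add_le_add (h1.trans (mul_le_mul_of_nonneg_left (mul_le_mul_of_nonneg_left h3 hK0) (by positivity))) h2
      _ = (T.card * (Real.exp (dec d * T.card) * Real.exp (dec d * c)) + c * Real.exp (dec d * c)) * (K * Φ) := by ring
      _ ≤ ((d + 1) * E + Lc * E) * (K * Φ) := by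
          refine mul_le_mul_of_nonneg_right (add_le_add ?_ ?_) (mul_nonneg hK0 hΦ0)
          · exact mul_le_mul hT heT (mul_nonneg heT0 hec0) (by positivity)
          · exact mul_le_mul hc' hec hec0 (Nat.cast_nonneg _)
      _ = ((Lc : ℝ) + (d + 1)) * E * (K * Φ) := by ring
  -- (b) the Whitney prolongation at each sample point is a convex combination of such values
  have hpt : ∀ (jj : Fin (d + 1) → Fin Lc) (t : Fin Lc),
      ‖(PcoMat Lc M j *ᵥ A) (castS Lc M j (cpt (Lc ^ j) Lc M z + off (Lc ^ j) Lc M jj + tstep (fine (Lc * Lc ^ j) M) ν t), ν) - A (z, ν)‖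
        ≤ ((Lc : ℝ) + (d + 1)) * E * (K * Φ) := by
    intro jj t
    rw [PcoMat_mulVec_apply, Equiv.symm_apply_apply]
    set q := cpt (Lc ^ j) Lc M z + off (Lc ^ j) Lc M jj + tstep (fine (Lc * Lc ^ j) M) ν t with hq
    set s := univ.erase ν with hs
    have hw0 : ∀ T ∈ s.powerset, 0 ≤ vwt s T (twR (Lc ^ j) Lc M q) := fun T hT =>
      vwt_nonneg (fun μ _ => twR_nonneg _ _ _ q μ) (fun μ _ => twR_le_one _ _ _ q μ) (mem_powerset.mp hT)
    have hw1 : ∑ T ∈ s.powerset, (vwt s T (twR (Lc ^ j) Lc M q) : ℂ) = 1 := by exact_mod_cast sum_vwt s (twR (Lc ^ j) Lc M q)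
    have e : ∑ T ∈ s.powerset, (vwt s T (twR (Lc ^ j) Lc M q) : ℂ) * A (par (Lc ^ j) Lc M q + vtx (fine (Lc ^ j) M) T, ν) - A (z, ν)
        = ∑ T ∈ s.powerset, (vwt s T (twR (Lc ^ j) Lc M q) : ℂ) * (A (par (Lc ^ j) Lc M q + vtx (fine (Lc ^ j) M) T, ν) - A (z, ν)) := by
      simp_rw [mul_sub]
      rw [sum_sub_distrib, ← sum_mul, hw1, one_mul]
    rw [e]
    refine (norm_sum_le _ _).trans ?_
    calc ∑ T ∈ s.powerset, ‖(vwt s T (twR (Lc ^ j) Lc M q) : ℂ) * (A (par (Lc ^ j) Lc M q + vtx (fine (Lc ^ j) M) T, ν) - A (z, ν))‖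
        ≤ ∑ T ∈ s.powerset, vwt s T (twR (Lc ^ j) Lc M q) * (((Lc : ℝ) + (d + 1)) * E * (K * Φ)) := sum_le_sum fun T hT => by
            rw [norm_mul, Complex.norm_real, Real.norm_of_nonneg (hw0 T hT)]
            exact mul_le_mul_of_nonneg_left (hval jj t T) (hw0 T hT)
      _ = ((Lc : ℝ) + (d + 1)) * E * (K * Φ) := by rw [← sum_mul, sum_vwt, one_mul]
  -- (c) the average over the `Lc^{d+2}` sample points of one Bałaban step
  rw [cstep_mulVec_apply]
  have hLcC : (Lc : ℂ) ≠ 0 := Nat.cast_ne_zero.mpr (NeZero.ne Lc)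
  have e2 : A (z, ν) = 1 / (Lc : ℂ) ^ (d + 1 + 1) * ∑ _jj : Fin (d + 1) → Fin Lc, ∑ _t : Fin Lc, A (z, ν) := by
    rw [sum_const, card_univ, nsmul_eq_mul, sum_const, card_univ, nsmul_eq_mul, Fintype.card_fun, Fintype.card_fin, Fintype.card_fin]
    push_cast
    field_simp
    ring
  rw [e2, ← mul_sub, ← sum_sub_distrib]
  simp_rw [← sum_sub_distrib]
  have hL : (Lc : ℝ) ≠ 0 := Nat.cast_ne_zero.mpr (NeZero.ne Lc)
  calc ‖1 / (Lc : ℂ) ^ (d + 1 + 1) * ∑ jj : Fin (d + 1) → Fin Lc, ∑ t : Fin Lc,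
          ((PcoMat Lc M j *ᵥ A) (castS Lc M j (cpt (Lc ^ j) Lc M z + off (Lc ^ j) Lc M jj + tstep (fine (Lc * Lc ^ j) M) ν t), ν) - A (z, ν))‖
      = 1 / (Lc : ℝ) ^ (d + 1 + 1) * ‖∑ jj : Fin (d + 1) → Fin Lc, ∑ t : Fin Lc,
          ((PcoMat Lc M j *ᵥ A) (castS Lc M j (cpt (Lc ^ j) Lc M z + off (Lc ^ j) Lc M jj + tstep (fine (Lc * Lc ^ j) M) ν t), ν) - A (z, ν))‖ := by
        rw [norm_mul, norm_div, norm_one, norm_pow, Complex.norm_natCast]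
    _ ≤ 1 / (Lc : ℝ) ^ (d + 1 + 1) * ∑ _jj : Fin (d + 1) → Fin Lc, ∑ _t : Fin Lc, ((Lc : ℝ) + (d + 1)) * E * (K * Φ) := by
        gcongr
        exact (norm_sum_le _ _).trans (sum_le_sum fun jj _ => (norm_sum_le _ _).trans (sum_le_sum fun t _ => hpt jj t))
    _ = ((Lc : ℝ) + (d + 1)) * E * (K * Φ) := by
        rw [sum_const, card_univ, nsmul_eq_mul, sum_const, card_univ, nsmul_eq_mul, Fintype.card_fun, Fintype.card_fin, Fintype.card_fin]
        push_cast
        field_simp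
        ring

/-- **THE LINE POINTS OF THE READING SEE THE SAME PROFILE up to `e^{dec}`**: `Φ_B(blk(n·y₀ + a + s e_ν)) ≤ e^{dec}·Φ_B(y₀)` for `s < n`
(`AveragingKernelRows.torusSupNorm_blockOf_line_le_one` + the triangle inequality of the block distance). [folklore] -/
theorem phi_blockOf_line_le (n : ℕ) [NeZero n] (B : Tor M × Fin (d + 1) → ℂ) (y₀ : Tor M) (a : Fin (d + 1) → Fin n) (ν : Fin (d + 1)) (s : Fin n) :
    ∑ y : Tor M, Real.exp (-(dec d * torusSupNorm M (rep M (blockOf n M (bpt n M y₀ a + tstep (fine n M) ν s)) - rep M y))) * ∑ lam : Fin (d + 1), ‖B (y, lam)‖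
      ≤ Real.exp (dec d) * ∑ y : Tor M, Real.exp (-(dec d * torusSupNorm M (rep M y₀ - rep M y))) * ∑ lam : Fin (d + 1), ‖B (y, lam)‖ := by
  set b := blockOf n M (bpt n M y₀ a + tstep (fine n M) ν s) with hb
  have h1 : torusSupNorm M (rep M y₀ - rep M b) ≤ 1 := by
    rw [torusSupNorm_rep_sub_comm]; exact torusSupNorm_blockOf_line_le_one n M y₀ a ν s
  rw [Finset.mul_sum]
  refine Finset.sum_le_sum fun y _ => ?_
  rw [← mul_assoc, ← Real.exp_add]
  refine mul_le_mul_of_nonneg_right (Real.exp_le_exp.mpr ?_) (Finset.sum_nonneg fun _ _ => norm_nonneg _)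
  have htri := torusSupNorm_rep_triangle M y₀ b y
  nlinarith [dec_pos d, htri, h1]

/-- **THE HONEST DEFECT AT A READ-OUT BOND**: `|δ_j(B)(y₀, ν)| ≤ (Lc+d+1)·e^{dec(Lc+d+2)}·CdecD∕Lc^j·Φ_B(y₀)` — the reading (1.18) is an average over line points whose blocks
lie within block distance one of `y₀`. [folklore] -/
theorem norm_honestDefect_apply_le (j : ℕ) (B : Tor M × Fin (d + 1) → ℂ) (y₀ : Tor M) (ν : Fin (d + 1)) :
    ‖(sread Lc M (j + 1) *ᵥ (PcoMat Lc M j *ᵥ (HkOp (Lc ^ j) M *ᵥ B)) - B) (y₀, ν)‖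
      ≤ ((Lc : ℝ) + (d + 1)) * Real.exp (dec d * ((Lc : ℝ) + (d + 1))) * Real.exp (dec d) *
          (CdecD d / ((Lc ^ j : ℕ) : ℝ) *
            ∑ y : Tor M, Real.exp (-(dec d * torusSupNorm M (rep M y₀ - rep M y))) * ∑ lam : Fin (d + 1), ‖B (y, lam)‖) := by
  set Φ₀ := ∑ y : Tor M, Real.exp (-(dec d * torusSupNorm M (rep M y₀ - rep M y))) * ∑ lam : Fin (d + 1), ‖B (y, lam)‖ with hΦ₀
  set W := ((Lc : ℝ) + (d + 1)) * Real.exp (dec d * ((Lc : ℝ) + (d + 1))) with hW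
  set K := CdecD d / ((Lc ^ j : ℕ) : ℝ) with hK
  have hK0 : 0 ≤ K := div_nonneg CdecD_nonneg (Nat.cast_nonneg _)
  have hW0 : 0 ≤ W := by positivity
  have hn : ((Lc ^ j : ℕ) : ℂ) ≠ 0 := Nat.cast_ne_zero.mpr (pow_ne_zero _ (NeZero.ne Lc))
  -- every line point is bounded by `W·K·e^{dec}·Φ₀`
  have hpt : ∀ (a : Fin (d + 1) → Fin (Lc ^ j)) (s : Fin (Lc ^ j)),
      ‖(cstep Lc M j *ᵥ (PcoMat Lc M j *ᵥ (HkOp (Lc ^ j) M *ᵥ B)) - HkOp (Lc ^ j) M *ᵥ B)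
          (bpt (Lc ^ j) M y₀ a + tstep (fine (Lc ^ j) M) ν s, ν)‖ ≤ W * Real.exp (dec d) * (K * Φ₀) := by
    intro a s
    rw [Pi.sub_apply]
    have hphi := phi_blockOf_line_le M (Lc ^ j) B y₀ a ν s
    have hmain := (norm_cstep_PcoMat_sub_le_decay Lc M j B (bpt (Lc ^ j) M y₀ a + tstep (fine (Lc ^ j) M) ν s) ν).trans
      (mul_le_mul_of_nonneg_left (mul_le_mul_of_nonneg_left hphi hK0) hW0)
    refine hmain.trans_eq ?_
    rw [hW, hK]
    ring
  rw [honestDefect_eq_sread, sread, QvOp_mulVec]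
  simp only [lineSum]
  calc ‖1 / ((Lc ^ j : ℕ) : ℂ) ^ (d + 1 + 1) * ∑ a : Fin (d + 1) → Fin (Lc ^ j), ∑ t : Fin (Lc ^ j),
          (cstep Lc M j *ᵥ (PcoMat Lc M j *ᵥ (HkOp (Lc ^ j) M *ᵥ B)) - HkOp (Lc ^ j) M *ᵥ B) (bpt (Lc ^ j) M y₀ a + tstep (fine (Lc ^ j) M) ν t, ν)‖
      = 1 / ((Lc ^ j : ℕ) : ℝ) ^ (d + 1 + 1) * ‖∑ a : Fin (d + 1) → Fin (Lc ^ j), ∑ t : Fin (Lc ^ j),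
          (cstep Lc M j *ᵥ (PcoMat Lc M j *ᵥ (HkOp (Lc ^ j) M *ᵥ B)) - HkOp (Lc ^ j) M *ᵥ B) (bpt (Lc ^ j) M y₀ a + tstep (fine (Lc ^ j) M) ν t, ν)‖ := by
        rw [norm_mul, norm_div, norm_one, norm_pow, Complex.norm_natCast]
    _ ≤ 1 / ((Lc ^ j : ℕ) : ℝ) ^ (d + 1 + 1) * ∑ _a : Fin (d + 1) → Fin (Lc ^ j), ∑ _t : Fin (Lc ^ j), W * Real.exp (dec d) * (K * Φ₀) := by
        gcongr
        exact (norm_sum_le _ _).trans (sum_le_sum fun a _ => (norm_sum_le _ _).trans (sum_le_sum fun t _ => hpt a t))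
    _ = W * Real.exp (dec d) * (K * Φ₀) := by
        have hL : (Lc : ℝ) ≠ 0 := Nat.cast_ne_zero.mpr (NeZero.ne Lc)
        rw [sum_const, card_univ, nsmul_eq_mul, sum_const, card_univ, nsmul_eq_mul, Fintype.card_fun, Fintype.card_fin, Fintype.card_fin]
        push_cast
        field_simp
        ring

end Defect

/-! ## §3 Young on the torus and the volume-free size of the honest defect -/

section Size

variable (Lc : ℕ) [NeZero Lc] (M : Fin (d + 1) → ℕ) [hM : ∀ μ, NeZero (M μ)]

omit [NeZero Lc] in
/-- **YOUNG ON THE TORUS**: `Σ_{y₀} Φ_B(y₀)² ≤ (d+1)·K_{d+1}(dec)²·nsq B` — weighted Cauchy–Schwarz with the volume-free row and column sums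
`Σ_y e^{−dec|y₀ − y|_T} ≤ K_{d+1}(dec)` (`sum_exp_torusSupNorm_sub_rep_le`, `torusSupNorm_rep_sub_comm`) and `(Σ_λ|B_λ(y)|)² ≤ (d+1)·Σ_λ|B_λ(y)|²`. [folklore] -/
theorem sum_phi_sq_le (B : Tor M × Fin (d + 1) → ℂ) :
    ∑ y₀ : Tor M, (∑ y : Tor M, Real.exp (-(dec d * torusSupNorm M (rep M y₀ - rep M y))) * ∑ lam : Fin (d + 1), ‖B (y, lam)‖) ^ 2
      ≤ ((d : ℝ) + 1) * latticeConst (d + 1) (dec d) ^ 2 * nsq B := by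
  set L := latticeConst (d + 1) (dec d) with hL
  set β : Tor M → ℝ := fun y => ∑ lam : Fin (d + 1), ‖B (y, lam)‖ with hβ
  have hβ0 : ∀ y, 0 ≤ β y := fun y => Finset.sum_nonneg fun _ _ => norm_nonneg _
  have hrow : ∀ y₀ : Tor M, ∑ y : Tor M, Real.exp (-(dec d * torusSupNorm M (rep M y₀ - rep M y))) ≤ L :=
    fun y₀ => sum_exp_torusSupNorm_sub_rep_le M (dec_pos d) (rep M y₀)
  have hcol : ∀ y : Tor M, ∑ y₀ : Tor M, Real.exp (-(dec d * torusSupNorm M (rep M y₀ - rep M y))) ≤ L := by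
    intro y
    simp_rw [torusSupNorm_rep_sub_comm M _ y]
    exact sum_exp_torusSupNorm_sub_rep_le M (dec_pos d) (rep M y)
  -- weighted Cauchy–Schwarz per row
  have hcs : ∀ y₀ : Tor M, (∑ y : Tor M, Real.exp (-(dec d * torusSupNorm M (rep M y₀ - rep M y))) * β y) ^ 2
      ≤ L * ∑ y : Tor M, Real.exp (-(dec d * torusSupNorm M (rep M y₀ - rep M y))) * β y ^ 2 := by
    intro y₀
    have h := Finset.sum_sq_le_sum_mul_sum_of_sq_le_mul (s := (univ : Finset (Tor M)))
      (r := fun y => Real.exp (-(dec d * torusSupNorm M (rep M y₀ - rep M y))) * β y)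
      (f := fun y => Real.exp (-(dec d * torusSupNorm M (rep M y₀ - rep M y))))
      (g := fun y => Real.exp (-(dec d * torusSupNorm M (rep M y₀ - rep M y))) * β y ^ 2)
      (fun y _ => (Real.exp_pos _).le) (fun y _ => mul_nonneg (Real.exp_pos _).le (sq_nonneg _)) (fun y _ => by ring_nf; exact le_rfl)
    refine h.trans ?_
    exact mul_le_mul_of_nonneg_right (hrow y₀) (Finset.sum_nonneg fun y _ => mul_nonneg (Real.exp_pos _).le (sq_nonneg _))
  have hβsq : ∀ y, β y ^ 2 ≤ ((d : ℝ) + 1) * ∑ lam : Fin (d + 1), ‖B (y, lam)‖ ^ 2 := by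
    intro y
    have h := sq_sum_le_card_mul_sum_sq (s := (univ : Finset (Fin (d + 1)))) (f := fun lam => ‖B (y, lam)‖)
    rw [card_univ, Fintype.card_fin] at h
    push_cast at h
    exact h
  have hnsq : nsq B = ∑ y : Tor M, ∑ lam : Fin (d + 1), ‖B (y, lam)‖ ^ 2 := by
    rw [nsq, Fintype.sum_prod_type]
  calc ∑ y₀ : Tor M, (∑ y : Tor M, Real.exp (-(dec d * torusSupNorm M (rep M y₀ - rep M y))) * β y) ^ 2
      ≤ ∑ y₀ : Tor M, L * ∑ y : Tor M, Real.exp (-(dec d * torusSupNorm M (rep M y₀ - rep M y))) * β y ^ 2 := sum_le_sum fun y₀ _ => hcs y₀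
    _ = L * ∑ y : Tor M, (∑ y₀ : Tor M, Real.exp (-(dec d * torusSupNorm M (rep M y₀ - rep M y)))) * β y ^ 2 := by
        rw [← mul_sum, sum_comm]; simp_rw [sum_mul]
    _ ≤ L * ∑ y : Tor M, L * (((d : ℝ) + 1) * ∑ lam : Fin (d + 1), ‖B (y, lam)‖ ^ 2) := by
        refine mul_le_mul_of_nonneg_left (sum_le_sum fun y _ => ?_) (latticeConst_nonneg _ (dec_pos d).le)
        exact mul_le_mul (hcol y) (hβsq y) (sq_nonneg _) (latticeConst_nonneg _ (dec_pos d).le)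
    _ = ((d : ℝ) + 1) * L ^ 2 * nsq B := by rw [← Finset.mul_sum, ← Finset.mul_sum, ← hnsq]; ring

/-- **THE SIZE OF THE HONEST ROW DEFECT, VOLUME-FREE**: for every `Lc ≥ 1`, every unit torus `M`, every level `j` and every datum `B`,
`nsq (Q_{Lc^{j+1}}(PcoMat j (H_{Lc^j}B)) − B) ≤ ((d+1)·K_{d+1}(dec)·(Lc+d+1)·e^{dec(Lc+d+1)}·e^{dec}·CdecD(d)∕Lc^j)²·nsq B` — the input `hδ` of
`WhitneyRowDefectGauge.squeeze_nsq_honest` ∕ `curlEnergy_HkOp_succ_sub_PcoLev_le` with `ρ_j = C(d, Lc)·Lc^{−j}` INDEPENDENT OF THE TORUS. [folklore] -/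
theorem nsq_honestDefect_le_decay (j : ℕ) (B : Tor M × Fin (d + 1) → ℂ) :
    nsq (sread Lc M (j + 1) *ᵥ (PcoMat Lc M j *ᵥ (HkOp (Lc ^ j) M *ᵥ B)) - B)
      ≤ (((d : ℝ) + 1) * latticeConst (d + 1) (dec d) *
          (((Lc : ℝ) + (d + 1)) * Real.exp (dec d * ((Lc : ℝ) + (d + 1))) * Real.exp (dec d) * CdecD d) / (Lc : ℝ) ^ j) ^ 2 * nsq B := by
  set W := ((Lc : ℝ) + (d + 1)) * Real.exp (dec d * ((Lc : ℝ) + (d + 1))) * Real.exp (dec d) * (CdecD d / ((Lc ^ j : ℕ) : ℝ)) with hW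
  have hpt : ∀ (y₀ : Tor M) (ν : Fin (d + 1)), ‖(sread Lc M (j + 1) *ᵥ (PcoMat Lc M j *ᵥ (HkOp (Lc ^ j) M *ᵥ B)) - B) (y₀, ν)‖
      ≤ W * ∑ y : Tor M, Real.exp (-(dec d * torusSupNorm M (rep M y₀ - rep M y))) * ∑ lam : Fin (d + 1), ‖B (y, lam)‖ := by
    intro y₀ ν
    have h := norm_honestDefect_apply_le Lc M j B y₀ ν
    rw [hW]
    linarith
  have hW0 : 0 ≤ W := by
    rw [hW]; exact mul_nonneg (by positivity) (div_nonneg CdecD_nonneg (Nat.cast_nonneg _))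
  have hY := sum_phi_sq_le M B
  calc nsq (sread Lc M (j + 1) *ᵥ (PcoMat Lc M j *ᵥ (HkOp (Lc ^ j) M *ᵥ B)) - B)
      = ∑ y₀ : Tor M, ∑ ν : Fin (d + 1), ‖(sread Lc M (j + 1) *ᵥ (PcoMat Lc M j *ᵥ (HkOp (Lc ^ j) M *ᵥ B)) - B) (y₀, ν)‖ ^ 2 := by
        rw [nsq, Fintype.sum_prod_type]
    _ ≤ ∑ y₀ : Tor M, ∑ _ν : Fin (d + 1),
          (W * ∑ y : Tor M, Real.exp (-(dec d * torusSupNorm M (rep M y₀ - rep M y))) * ∑ lam : Fin (d + 1), ‖B (y, lam)‖) ^ 2 :=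
        sum_le_sum fun y₀ _ => sum_le_sum fun ν _ => pow_le_pow_left₀ (norm_nonneg _) (hpt y₀ ν) 2
    _ = ((d : ℝ) + 1) * W ^ 2 *
          ∑ y₀ : Tor M, (∑ y : Tor M, Real.exp (-(dec d * torusSupNorm M (rep M y₀ - rep M y))) * ∑ lam : Fin (d + 1), ‖B (y, lam)‖) ^ 2 := by
        simp only [sum_const, card_univ, Fintype.card_fin, nsmul_eq_mul]
        rw [mul_sum]
        refine sum_congr rfl fun y₀ _ => ?_
        push_cast
        ring
    _ ≤ ((d : ℝ) + 1) * W ^ 2 * (((d : ℝ) + 1) * latticeConst (d + 1) (dec d) ^ 2 * nsq B) :=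
        mul_le_mul_of_nonneg_left hY (by positivity)
    _ = (((d : ℝ) + 1) * latticeConst (d + 1) (dec d) *
          (((Lc : ℝ) + (d + 1)) * Real.exp (dec d * ((Lc : ℝ) + (d + 1))) * Real.exp (dec d) * CdecD d) / (Lc : ℝ) ^ j) ^ 2 * nsq B := by
        rw [hW, Nat.cast_pow]
        ring

end Size

end Summit.QuantumFields.BalabanUV.Beta.GAN24.WhitneyRowDefectBoundDecay

end
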